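import Summits.HodgeConjecture.HodgeConjecture.Theorems.PadicSemiregularLiftFermatAnchorAssemblyStubTransferLeaf
import Summits.HodgeConjecture.HodgeConjecture.Theorems.FermatAnchorAssembly.Negative.StubZeroOneSeedsAnchoredSuffice

/-!
# Crux `FermatAnchorAssembly` (stmt-HodgeConjecture-14874), line `Sketch`: the composition over its CHILDREN as named
# hypotheses (helper, `--supports`; lead c3, 2026-08-16)

Route `PadicSemiregularLift` of `HodgeConjecture`; crux
`FermatAnchorAssembly := PadicPridhamSemiregularity → FormalLiftingFromClassLifting → FormalVectorBundlesAlgebraize →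
HodgeFermatVarieties`. The line skeleton `Cruxes/FermatAnchorAssembly/Lines/Sketch.lean` (gen 8) closes the crux modulo
five registered stubs; this importable, sorry-free file records the SAME composition with the five stub statements turned
into explicit hypotheses (verbatim signatures), so that the crux's position above its children is a kernel-checked theorem
and the planner's foreseen glued split (item text: `FermatLiftSeeds → FermatDescent → FermatAnchorAssembly`) can be typed
against names that exist:

* `fermatAnchorAssembly_of_leaf_facts_of_anchors_of_anchoredSeeds` — the three LEAF print facts
  (`FermatHodgeClassesLiftToCurvePowersSum`, `two_mul_dim_eq_finrank_bettiCohomology`, `nonempty_jacobian_of_algPoints`)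
  + `stub_anchors`' statement + `stub_anchoredSeeds`' statement ⊢ crux, the engine h1b/h1a/h3a CONSUMED
  (via the landed `stub_transfer_of_leaf_facts`, p127549, and `hodgeFermatJacobianPowersAt_of_exists_anchored`, p102534);
* `fermatAnchorAssembly_of_leaf_facts_of_exists_anchored` — the same over the disprover's merged `∃`-anchored seed
  statement (one hypothesis for anchors-with-seeds; Disproof.lean §3 `FermatJacobianAnchoredSeeds`, unfolded);
* `fermatAnchorAssembly_of_leaf_facts_of_hodgeFermatJacobianPowers` — the HC-sandwich at the hosts: leaf facts + HC for
  every power of every Fermat Jacobian ⊢ crux with the engine UNUSED (what any seed statement is measured against: by the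
  landed tightness `FermatAnchorAssemblyNegative.middleCyclePart_of_zeroOneSeedsFor` the seed hypothesis of the first two
  theorems already yields this one's hypothesis in the middle degrees).

Nothing is asserted: no stub is proved here and no statement is introduced; the five hypotheses are exactly the registered
stub signatures of skeleton gen 8 (sha recorded by `ledger skeleton check`, lead prover-line-stmt-HodgeConjecture-14874-c3-0).
-/

-- `Summit.HodgeConjecture.HodgeConjecture.…` is the tree's mandated summit/problem namespace (single-problem summit).
set_option linter.dupNamespace false

noncomputable section

open CategoryTheory AlgebraicGeometry
open scoped Isocrystal
open Literature.AlgebraicGeometry Literature.AlgebraicGeometry.Motives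
  Literature.AlgebraicGeometry.HodgeTheory Literature.AlgebraicGeometry.Crystalline
  Literature.AlgebraicGeometry.Crystalline.PadicAnchor Literature.AlgebraicGeometry.KTheory
open Summit.HodgeConjecture.HodgeConjecture.Theses.PadicSemiregularLift
open Summit.HodgeConjecture.HodgeConjecture.Theorems.FermatAnchorAssemblyNegative

namespace Summit.HodgeConjecture.HodgeConjecture.Cruxes.FermatAnchorAssembly.ParallelizableAvatar

/-- **The crux from its five children** (registered sub-goal of line `Sketch`, gen 8): the three leaf print facts of the
transfer, the anchor statement of `stub_anchors` and the `∃`-anchored seed statement of `stub_anchoredSeeds` (all verbatim)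
imply `FermatAnchorAssembly`, the engine hypotheses h1b, h1a, h3a being consumed at the anchored host of each power of each
Fermat Jacobian. This is the skeleton's `FermatAnchorAssembly_of` with its stubs abstracted. [folklore] -/
theorem fermatAnchorAssembly_of_leaf_facts_of_anchors_of_anchoredSeeds : Literature.AlgebraicGeometry.HodgeTheory.FermatHodgeClassesLiftToCurvePowersSum → two_mul_dim_eq_finrank_bettiCohomology → nonempty_jacobian_of_algPoints.{0} → (∀ (m : ℕ) (C : SchemeOver ℂ) (𝒥 : Jacobian C), IsFermatVariety 1 m C → IsSmoothProjective 1 C → ∀ N : ℕ, HasGenuineSpanningAnchor (𝒥.J.powSucc N).dim (𝒥.J.powSucc N).X) → (∀ (m : ℕ) (C : SchemeOver ℂ) (𝒥 : Jacobian C), IsFermatVariety 1 m C → IsSmoothProjective 1 C → ∀ N : ℕ, HasGenuineSpanningAnchor (𝒥.J.powSucc N).dim (𝒥.J.powSucc N).X → ∃ D : Anchor (𝒥.J.powSucc N).dim (𝒥.J.powSucc N).X, D.IsGenuine ∧ D.SpansHodge ∧ ZeroOneSeedsFor D.C (𝒥.J.powSucc N).dim D.𝒴) → FermatAnchorAssembly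 :=
  fun hSK hdim hJ hA hZ h1b h1a h3a =>
    stub_transfer_of_leaf_facts hSK hdim hJ
      (hodgeFermatJacobianPowersAt_of_exists_anchored h1b h1a h3a
        fun m C 𝒥 hF hC N => hZ m C 𝒥 hF hC N (hA m C 𝒥 hF hC N))

/-- **The crux from the leaf facts and ONE `∃`-anchored seed statement** (registered sub-goal; the disprover's merged
form, Disproof.lean §3 `FermatJacobianAnchoredSeeds`, unfolded): every power of every Fermat Jacobian has a genuine,
spanning anchor carrying `{0,1}`-seeds ⊢ crux, engine consumed. [folklore] -/
theorem fermatAnchorAssembly_of_leaf_facts_of_exists_anchored : Literature.AlgebraicGeometry.HodgeTheory.FermatHodgeClassesLiftToCurvePowersSum → two_mul_dim_eq_finrank_bettiCohomology → nonempty_jacobian_of_algPoints.{0} → (∀ (m : ℕ) (C : SchemeOver ℂ) (𝒥 : Jacobian C), IsFermatVariety 1 m C → IsSmoothProjective 1 C → ∀ N : ℕ, ∃ D : Anchor (𝒥.J.powSucc N).dim (𝒥.J.powSucc N).X, D.IsGenuine ∧ D.SpansHodge ∧ ZeroOneSeedsFor D.C (𝒥.J.powSucc N).dim D.𝒴) →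 FermatAnchorAssembly :=
  fun hSK hdim hJ h h1b h1a h3a =>
    stub_transfer_of_leaf_facts hSK hdim hJ (hodgeFermatJacobianPowersAt_of_exists_anchored h1b h1a h3a h)

/-- **The HC-sandwich at the hosts** (registered sub-goal): the leaf facts and the Hodge conjecture for every power of
every Fermat Jacobian (`HodgeFermatJacobianPowersAt`) give the crux with the engine hypotheses UNUSED — the class-level
statement every seed hypothesis is measured against (landed tightness: seeds + engine ⊢ `MiddleCyclePart` of each host).
[folklore] -/
theorem fermatAnchorAssembly_of_leaf_facts_of_hodgeFermatJacobianPowers : Literature.AlgebraicGeometry.HodgeTheory.FermatHodgeClassesLiftToCurvePowersSum → two_mul_dim_eq_finrank_bettiCohomology → nonempty_jacobian_of_algPoints.{0} → (∀ (m : ℕ) (C : SchemeOver ℂ) (𝒥 : Jacobian C), HodgeFermatJacobianPowersAt m C 𝒥) → FermatAnchorAssembly :=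
  fun hSK hdim hJ H _ _ _ => stub_transfer_of_leaf_facts hSK hdim hJ H

end Summit.HodgeConjecture.HodgeConjecture.Cruxes.FermatAnchorAssembly.ParallelizableAvatar

end
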